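import Mathlib
import Summits.ValiantsHypothesis.ValiantsHypothesis.Theses.FeketeSOS
import Summits.ValiantsHypothesis.ValiantsHypothesis.Theorems.CharPSparseSOS.Negative.LoadBearing
import Summits.ValiantsHypothesis.ValiantsHypothesis.Theorems.FeketeSOSCharPSparseSOSTwoCuspTrivial

/-!
# Crux `FeketeSOS.CharPSparseSOS` (stmt-ValiantsHypothesis-14989), line `Sketch` — the QR-perfect
restricted sum set barrier

A finite set `Q ⊆ [0, p)` is a *QR-perfect restricted sum set* modulo the prime `p` if every non-zero
quadratic residue `n (mod p)` is `a + b (mod p)` for EXACTLY ONE pair `a < b` in `Q`, and no other residue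
(`0` or a non-residue) is such a restricted sum.  Such a `Q` has `|Q| = O(√p)` and yields, in `(ZMod p)[X]`,
the cyclic identity `Cq² ≡ Dq + 2 R (mod X^p − 1)` with `Cq = ∑_{a ∈ Q} X^a`, `Dq = ∑_{a ∈ Q} X^{2a mod p}`,
`R = ∑_{n QR, n ≠ 0} X^n`; since the reduced Fekete polynomial is `F̄_p = 2 R − (X + ⋯ + X^{p−1})` and the
all-ones polynomial is two products of digit polynomials (`ones_digit_identity`), `F̄_p` becomes a weighted
sum of SEVEN squares of degree `< p` and support-sum `O(√p)`:
`F̄_p ≡ Cq² − ¼(1+Dq)² + ¼(1−Dq)² − ¼(P+Q)² + ¼(P−Q)² − ¼(M+T)² + ¼(M−T)²`.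
Hence the crux `CharPSparseSOS` (support-sum `≥ p^{1/2+δ}` for `s ≤ p^δ` squares) excludes QR-perfect
restricted sum sets for all large primes: `no_qrPerfectSumSet_of_charPSparseSOS`.  This is the kernel-checked
form of the Paley sum-clique partition barrier (a proof of the crux must in particular rule out such `Q`).
-/

-- `Summit.ValiantsHypothesis.ValiantsHypothesis.…` is the tree's mandated single-conjunct layout (Sub = Summit).
set_option linter.dupNamespace false

namespace Summit.ValiantsHypothesis.ValiantsHypothesis.Theorems.CharPSparseSOSTwoCusp

open Polynomial Finset
open Summit.ValiantsHypothesis.ValiantsHypothesis.Theorems.CharPSparseSOS.Negative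
  (lowDigits highDigits card_support_add_le card_support_sub_le card_support_sum_X_pow_le
    card_support_X_pow_le card_support_lowDigits card_support_highDigits natDegree_lowDigits
    natDegree_highDigits ones_digit_identity four_ne_zero_zmod)

noncomputable section

variable {K : Type} [Field K]

/-! ## Combinatorics of restricted pair sums -/

/-- Swap symmetry: a sum over the pairs `b < a` of `Q × Q` is the sum over the pairs `a < b` of the
swapped summand. -/
theorem qrp_sum_gt_eq_sum_lt {M : Type*} [AddCommMonoid M] (Q : Finset ℕ) (f : ℕ × ℕ → M) :
    ∑ ab ∈ (Q ×ˢ Q).filter (fun ab : ℕ × ℕ => ab.2 < ab.1), f ab =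
      ∑ ab ∈ (Q ×ˢ Q).filter (fun ab : ℕ × ℕ => ab.1 < ab.2), f ab.swap := by
  refine sum_equiv (Equiv.prodComm ℕ ℕ) (fun ab => ?_) (fun ab _ => rfl)
  simp only [mem_filter, mem_product, Equiv.prodComm_apply, Prod.fst_swap, Prod.snd_swap]
  tauto

/-- Trichotomy split of a sum over `Q × Q` into the pairs `a < b`, the swapped pairs, and the
diagonal. -/
theorem qrp_sum_product_split {M : Type*} [AddCommMonoid M] (Q : Finset ℕ) (f : ℕ × ℕ → M) :
    ∑ ab ∈ Q ×ˢ Q, f ab =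
      ∑ ab ∈ (Q ×ˢ Q).filter (fun ab : ℕ × ℕ => ab.1 < ab.2), f ab +
      ∑ ab ∈ (Q ×ˢ Q).filter (fun ab : ℕ × ℕ => ab.1 < ab.2), f ab.swap +
      ∑ a ∈ Q, f (a, a) := by
  rw [← qrp_sum_gt_eq_sum_lt,
    ← sum_filter_add_sum_filter_not (Q ×ˢ Q) (fun ab : ℕ × ℕ => ab.1 < ab.2) f, add_assoc]
  congr 1
  rw [← sum_filter_add_sum_filter_not ((Q ×ˢ Q).filter (fun ab : ℕ × ℕ => ¬ ab.1 < ab.2))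
    (fun ab : ℕ × ℕ => ab.2 < ab.1) f, filter_filter, filter_filter]
  congr 1
  · exact sum_congr (filter_congr fun ab _ => by omega) fun _ _ => rfl
  · rw [sum_filter, sum_product]
    refine sum_congr rfl fun a ha => ?_
    rw [sum_eq_single a (fun b _ hb => if_neg (by dsimp only; omega)) (fun h => (h ha).elim),
      if_pos (by dsimp only; omega)]

/-- **Size of a QR-perfect restricted sum set.**  If every residue is a restricted sum `a + b`, `a < b`,
of at most one pair (as the perfectness hypothesis forces), then `|Q|² ≤ 2p + |Q|`. -/
theorem qrp_card_sq_le (p : ℕ) [Fact p.Prime] (Q : Finset ℕ)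
    (hperf : ∀ n : ℕ, n < p → ((Q ×ˢ Q).filter
      (fun ab : ℕ × ℕ => ab.1 < ab.2 ∧ (ab.1 + ab.2) % p = n)).card =
        if n ≠ 0 ∧ legendreSym p n = 1 then 1 else 0) :
    Q.card * Q.card ≤ 2 * p + Q.card := by
  set S := (Q ×ˢ Q).filter (fun ab : ℕ × ℕ => ab.1 < ab.2) with hS
  have hp : 0 < p := (Fact.out : p.Prime).pos
  have hS_le : S.card ≤ p := by
    have h := card_le_mul_card_image_of_maps_to (s := S) (t := range p)
      (f := fun ab : ℕ × ℕ => (ab.1 + ab.2) % p) (fun ab _ => mem_range.2 (Nat.mod_lt _ hp)) 1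
      (fun n hn => by
        have h1 := hperf n (mem_range.1 hn)
        rw [hS, filter_filter, h1]
        split_ifs <;> simp)
    simpa using h
  have hcover : Q ×ˢ Q ⊆ S ∪ S.image Prod.swap ∪ Q.image (fun a => (a, a)) := by
    rintro ⟨x, y⟩ hxy
    rw [mem_product] at hxy
    rcases Nat.lt_trichotomy x y with h | h | h
    · exact mem_union_left _ (mem_union_left _ (mem_filter.2 ⟨mem_product.2 hxy, h⟩))
    · subst h
      exact mem_union_right _ (mem_image.2 ⟨x, hxy.1, rfl⟩)
    · exact mem_union_left _ (mem_union_right _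
        (mem_image.2 ⟨(y, x), mem_filter.2 ⟨mem_product.2 ⟨hxy.2, hxy.1⟩, h⟩, rfl⟩))
  calc Q.card * Q.card = (Q ×ˢ Q).card := (card_product Q Q).symm
    _ ≤ (S ∪ S.image Prod.swap ∪ Q.image (fun a => (a, a))).card := card_le_card hcover
    _ ≤ S.card + S.card + Q.card :=
        (card_union_le _ _).trans (add_le_add ((card_union_le _ _).trans
          (add_le_add le_rfl card_image_le)) card_image_le)
    _ ≤ 2 * p + Q.card := by omega

/-! ## Folding modulo `X^p − 1` and the Fekete pattern -/

/-- Folding the square of a monomial sum modulo `X^p − 1` (`tct_X_pow_sub_one_dvd`):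
`(∑_{a ∈ Q} X^a)² = ∑_{(a,b) ∈ Q × Q} X^{a+b} ≡ ∑_{(a,b)} X^{(a+b) mod p}`. -/
theorem qrp_dvd_sq_sub_fold (p : ℕ) (Q : Finset ℕ) :
    (X : K[X]) ^ p - 1 ∣ (∑ a ∈ Q, (X : K[X]) ^ a) ^ 2 -
      ∑ ab ∈ Q ×ˢ Q, (X : K[X]) ^ ((ab.1 + ab.2) % p) := by
  have hsq : (∑ a ∈ Q, (X : K[X]) ^ a) ^ 2 = ∑ ab ∈ Q ×ˢ Q, (X : K[X]) ^ (ab.1 + ab.2) := by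
    rw [sq, sum_mul_sum, sum_product]
    simp only [pow_add]
  rw [hsq, ← sum_sub_distrib]
  exact dvd_sum fun ab _ => tct_X_pow_sub_one_dvd p _

/-- **Fold identity** (no hypothesis on `Q`): modulo `X^p − 1`,
`(∑_{a∈Q} X^a)² ≡ ∑_{a∈Q} X^{2a mod p} + 2 ∑_{n<p} #{a<b in Q : a+b ≡ n} X^n`
(trichotomy split, swap symmetry, and regrouping of the pairs `a < b` by their residue). -/
theorem qrp_fold_identity (p : ℕ) (hp : 0 < p) (Q : Finset ℕ) :
    (X : K[X]) ^ p - 1 ∣ (∑ a ∈ Q, (X : K[X]) ^ a) ^ 2 -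
      (∑ a ∈ Q, (X : K[X]) ^ ((2 * a) % p) +
        2 * ∑ n ∈ range p, ((((Q ×ˢ Q).filter (fun ab : ℕ × ℕ => ab.1 < ab.2)).filter
          (fun ab : ℕ × ℕ => (ab.1 + ab.2) % p = n)).card : K[X]) * X ^ n) := by
  have hfib : ∑ ab ∈ (Q ×ˢ Q).filter (fun ab : ℕ × ℕ => ab.1 < ab.2),
      (X : K[X]) ^ ((ab.1 + ab.2) % p) =
      ∑ n ∈ range p, ((((Q ×ˢ Q).filter (fun ab : ℕ × ℕ => ab.1 < ab.2)).filter
          (fun ab : ℕ × ℕ => (ab.1 + ab.2) % p = n)).card : K[X]) * X ^ n := by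
    rw [← sum_fiberwise_of_maps_to' (g := fun ab : ℕ × ℕ => (ab.1 + ab.2) % p) (t := range p)
      (fun ab _ => mem_range.2 (Nat.mod_lt _ hp)) (fun n => (X : K[X]) ^ n)]
    refine sum_congr rfl fun n _ => ?_
    rw [sum_const, nsmul_eq_mul]
  have hsplit := qrp_sum_product_split Q (fun ab : ℕ × ℕ => (X : K[X]) ^ ((ab.1 + ab.2) % p))
  simp only [Prod.fst_swap, Prod.snd_swap] at hsplit
  have hcomm : ∑ ab ∈ (Q ×ˢ Q).filter (fun ab : ℕ × ℕ => ab.1 < ab.2),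
      (X : K[X]) ^ ((ab.2 + ab.1) % p) =
      ∑ ab ∈ (Q ×ˢ Q).filter (fun ab : ℕ × ℕ => ab.1 < ab.2), (X : K[X]) ^ ((ab.1 + ab.2) % p) :=
    sum_congr rfl fun ab _ => by rw [add_comm]
  have hdiag : ∑ a ∈ Q, (X : K[X]) ^ ((a + a) % p) = ∑ a ∈ Q, (X : K[X]) ^ ((2 * a) % p) :=
    sum_congr rfl fun a _ => by rw [two_mul]
  rw [hcomm, hdiag, hfib, ← two_mul, add_comm] at hsplit
  rw [← hsplit]
  exact qrp_dvd_sq_sub_fold p Q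

/-- Under the perfectness hypothesis the pair counts are the indicator of the non-zero quadratic
residues. -/
theorem qrp_count_sum_eq (p : ℕ) [Fact p.Prime] (Q : Finset ℕ)
    (hperf : ∀ n : ℕ, n < p → ((Q ×ˢ Q).filter
      (fun ab : ℕ × ℕ => ab.1 < ab.2 ∧ (ab.1 + ab.2) % p = n)).card =
        if n ≠ 0 ∧ legendreSym p n = 1 then 1 else 0) :
    (∑ n ∈ range p, ((((Q ×ˢ Q).filter (fun ab : ℕ × ℕ => ab.1 < ab.2)).filter
          (fun ab : ℕ × ℕ => (ab.1 + ab.2) % p = n)).card : K[X]) * X ^ n) =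
      ∑ n ∈ range p, if n ≠ 0 ∧ legendreSym p n = 1 then (X : K[X]) ^ n else 0 := by
  refine sum_congr rfl fun n hn => ?_
  rw [filter_filter, hperf n (mem_range.1 hn)]
  split_ifs <;> simp

/-- The value pattern of the Legendre symbol: `χ_p(m) X^m = 2·[m ≠ 0 QR] X^m − [m ≠ 0] X^m` for `m < p`. -/
theorem qrp_legendre_term (p : ℕ) [Fact p.Prime] (m : ℕ) (hm : m < p) :
    C ((legendreSym p m : ℤ) : K) * X ^ m =
      2 * (if m ≠ 0 ∧ legendreSym p m = 1 then (X : K[X]) ^ m else 0) -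
        (if m ≠ 0 then (X : K[X]) ^ m else 0) := by
  rcases Nat.eq_zero_or_pos m with rfl | hm0
  · simp [legendreSym.at_zero]
  · have hne : ((m : ℤ) : ZMod p) ≠ 0 := by
      rw [Int.cast_natCast, Ne, ZMod.natCast_eq_zero_iff]
      exact Nat.not_dvd_of_pos_of_lt hm0 hm
    rcases legendreSym.eq_one_or_neg_one p hne with h | h
    · rw [if_pos ⟨hm0.ne', h⟩, if_pos hm0.ne', h, Int.cast_one, C_1]
      ring
    · have hc : ¬ (m ≠ 0 ∧ legendreSym p m = 1) := fun h' => by rw [h] at h'; norm_num at h'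
      rw [if_neg hc, if_pos hm0.ne', h, Int.cast_neg, Int.cast_one, C_neg, C_1]
      ring

/-- **The reduced Fekete polynomial is `2 R − (X + ⋯ + X^{p−1})`** with `R` the indicator polynomial of the
non-zero quadratic residues. -/
theorem qrp_fekete_eq (p : ℕ) [Fact p.Prime] :
    (∑ m ∈ range p, C ((legendreSym p m : ℤ) : K) * X ^ m) =
      2 * (∑ m ∈ range p, if m ≠ 0 ∧ legendreSym p m = 1 then (X : K[X]) ^ m else 0) -
        ∑ m ∈ range (p - 1), (X : K[X]) ^ (m + 1) := by
  have hones : (∑ m ∈ range (p - 1), (X : K[X]) ^ (m + 1)) =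
      ∑ m ∈ range p, if m ≠ 0 then (X : K[X]) ^ m else 0 := by
    obtain ⟨N, hN⟩ : ∃ N, p = N + 1 :=
      ⟨p - 1, (Nat.succ_pred_eq_of_pos (Fact.out : p.Prime).pos).symm⟩
    rw [hN, Nat.add_sub_cancel, sum_range_succ', if_neg (fun h => h rfl), add_zero]
    exact sum_congr rfl fun m _ => (if_pos (Nat.succ_ne_zero m)).symm
  rw [hones, mul_sum, ← sum_sub_distrib]
  exact sum_congr rfl fun m hm => qrp_legendre_term p m (mem_range.1 hm)

/-! ## The seven-square witness -/

/-- `Cq² − ¼(1+Dq)² + ¼(1−Dq)² − ¼(P+Q)² + ¼(P−Q)² − ¼(M+T)² + ¼(M−T)² = Cq² − Dq − (PQ + MT)`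
whenever `4 ≠ 0` in `K`. -/
theorem qrp_seven_sum (h4 : (4 : K) ≠ 0) (Cq Dq P Q M T : K[X]) :
    (∑ i, C ((![1, -1 / 4, 1 / 4, -1 / 4, 1 / 4, -1 / 4, 1 / 4] : Fin 7 → K) i) *
        (![Cq, 1 + Dq, 1 - Dq, P + Q, P - Q, M + T, M - T] : Fin 7 → K[X]) i ^ 2) =
      Cq ^ 2 - Dq - (P * Q + M * T) := by
  have h4' : C (1 / 4 : K) * 4 = 1 := by
    rw [show (4 : K[X]) = C 4 from (map_ofNat C 4).symm, ← C_mul, ← C_1]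
    congr 1; field_simp
  have hneg : C (-1 / 4 : K) = -C (1 / 4 : K) := by
    rw [← map_neg]; congr 1; ring
  simp only [Fin.sum_univ_seven, Matrix.cons_val_zero, Matrix.cons_val_one, Matrix.cons_val, hneg, C_1,
    one_mul]
  linear_combination (-(Dq + P * Q + M * T)) * h4'

/-- **The seven-square witness.**  For `Q ⊆ [0, N]` satisfying the perfectness hypothesis modulo the prime
`N + 1` and a tiling `N = ab + r` (`1 ≤ r`, `a ≤ N`), the weights `1, −¼, ¼, −¼, ¼, −¼, ¼` and the bases
`Cq = ∑_{x∈Q} X^x`, `1 ± Dq` (`Dq = ∑_{x∈Q} X^{2x mod (N+1)}`), `lowDigits a ± highDigits a b`,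
`X^{ab+1} ± (1 + ⋯ + X^{r−1})` form a cyclic representation of `F̄_{N+1}` of degree `< N + 1` and support-sum
`≤ 3|Q| + 2(a + b + r) + 4`. -/
theorem qrp_witness (N : ℕ) [Fact (N + 1).Prime] (h4 : (4 : K) ≠ 0) (Q : Finset ℕ)
    (hQ : ∀ x ∈ Q, x < N + 1)
    (hperf : ∀ n : ℕ, n < N + 1 → ((Q ×ˢ Q).filter
      (fun ab : ℕ × ℕ => ab.1 < ab.2 ∧ (ab.1 + ab.2) % (N + 1) = n)).card =
        if n ≠ 0 ∧ legendreSym (N + 1) n = 1 then 1 else 0)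
    (a b r : ℕ) (hN : N = a * b + r) (hr : 1 ≤ r) (ha : a ≤ N) :
    ∃ (c : Fin 7 → K) (g : Fin 7 → K[X]), (∀ i, (g i).natDegree < N + 1) ∧
      ((X : K[X]) ^ (N + 1) - 1 ∣ (∑ i, C (c i) * g i ^ 2) -
        ∑ m ∈ range (N + 1), C ((legendreSym (N + 1) m : ℤ) : K) * X ^ m) ∧
      (∑ i, ((g i).support.card : ℝ)) ≤ 3 * Q.card + 2 * (a + b + r) + 4 := by
  set Cq : K[X] := ∑ x ∈ Q, X ^ x with hCq
  set Dq : K[X] := ∑ x ∈ Q, X ^ ((2 * x) % (N + 1)) with hDq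
  set M : K[X] := X ^ (a * b + 1) with hM
  set T : K[X] := ∑ k ∈ range r, X ^ k with hT
  refine ⟨![1, -1 / 4, 1 / 4, -1 / 4, 1 / 4, -1 / 4, 1 / 4],
    ![Cq, 1 + Dq, 1 - Dq, lowDigits K a + highDigits K a b, lowDigits K a - highDigits K a b, M + T, M - T],
    ?_, ?_, ?_⟩
  · -- degrees
    have hC : Cq.natDegree ≤ N :=
      natDegree_sum_le_of_forall_le _ _ fun x hx => (natDegree_X_pow_le _).trans (by
        have := hQ x hx; omega)
    have hD : Dq.natDegree ≤ N :=
      natDegree_sum_le_of_forall_le _ _ fun x _ => (natDegree_X_pow_le _).trans (by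
        have := Nat.mod_lt (2 * x) (show 0 < N + 1 by omega); omega)
    have hl : (lowDigits K a).natDegree ≤ N := (natDegree_lowDigits a).trans ha
    have hh : (highDigits K a b).natDegree ≤ N :=
      (natDegree_highDigits a b).trans (le_trans (Nat.mul_le_mul_left a (Nat.sub_le b 1)) (by omega))
    have hM' : M.natDegree ≤ N := (natDegree_X_pow_le _).trans (by omega)
    have hT' : T.natDegree ≤ N :=
      natDegree_sum_le_of_forall_le _ _ fun k hk => (natDegree_X_pow_le _).trans (by
        have := mem_range.mp hk; omega)
    have h1 : (1 : K[X]).natDegree ≤ N := by simp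
    intro i
    refine Nat.lt_succ_of_le ?_
    fin_cases i
    · exact hC
    · exact (natDegree_add_le _ _).trans (max_le h1 hD)
    · exact (natDegree_sub_le _ _).trans (max_le h1 hD)
    · exact (natDegree_add_le _ _).trans (max_le hl hh)
    · exact (natDegree_sub_le _ _).trans (max_le hl hh)
    · exact (natDegree_add_le _ _).trans (max_le hM' hT')
    · exact (natDegree_sub_le _ _).trans (max_le hM' hT')
  · -- the cyclic identity
    rw [qrp_seven_sum h4, hM, hT, ← ones_digit_identity a b r, ← hN, qrp_fekete_eq, Nat.add_sub_cancel]
    have hfold := qrp_fold_identity (K := K) (N + 1) (Nat.succ_pos N) Q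
    rw [qrp_count_sum_eq (N + 1) Q hperf] at hfold
    convert hfold using 1
    ring
  · -- support-sum bookkeeping
    have hC : (Cq.support.card : ℝ) ≤ Q.card := by
      exact_mod_cast card_support_sum_X_pow_le Q (fun x => x)
    have hD : (Dq.support.card : ℝ) ≤ Q.card := by
      exact_mod_cast card_support_sum_X_pow_le Q (fun x => (2 * x) % (N + 1))
    have hl : ((lowDigits K a).support.card : ℝ) ≤ a := by exact_mod_cast card_support_lowDigits a
    have hh : ((highDigits K a b).support.card : ℝ) ≤ b := by
      exact_mod_cast card_support_highDigits a b
    have hM' : (M.support.card : ℝ) ≤ 1 := by exact_mod_cast card_support_X_pow_le _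
    have hT' : (T.support.card : ℝ) ≤ r := by
      have : T.support.card ≤ r := (card_support_sum_X_pow_le (range r) id).trans (by simp)
      exact_mod_cast this
    have h1 : ((1 : K[X]).support.card : ℝ) ≤ 1 := by
      have := card_support_X_pow_le (K := K) 0
      rw [pow_zero] at this; exact_mod_cast this
    -- `|supp (A ± B)| ≤ |supp A| + |supp B|` for the six composite bases
    have e := fun (A B : K[X]) => (Nat.cast_le (α := ℝ)).2 (card_support_add_le A B)
    have e' := fun (A B : K[X]) => (Nat.cast_le (α := ℝ)).2 (card_support_sub_le A B)
    have e1 := e 1 Dq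
    have e2 := e' 1 Dq
    have e3 := e (lowDigits K a) (highDigits K a b)
    have e4 := e' (lowDigits K a) (highDigits K a b)
    have e5 := e M T
    have e6 := e' M T
    push_cast at e1 e2 e3 e4 e5 e6
    simp only [Fin.sum_univ_seven, Matrix.cons_val_zero, Matrix.cons_val_one, Matrix.cons_val]
    linarith

/-! ## The barrier -/

/-- **No QR-perfect restricted sum sets (from the crux).**  `CharPSparseSOS` implies that for all large
primes `p` no `Q ⊆ [0, p)` has every non-zero quadratic residue as a restricted sum `a + b (mod p)`,
`a < b` in `Q`, of exactly one pair and no other residue as such a sum: such a `Q` would give the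
seven-square cyclic representation `qrp_witness` of `F̄_p` of degree `< p` and support-sum `≤ 12√p + 11`,
against the crux's `p^{1/2+δ} ≥ 23 √p`. -/
theorem no_qrPerfectSumSet_of_charPSparseSOS :
    Summit.ValiantsHypothesis.ValiantsHypothesis.Theses.FeketeSOS.CharPSparseSOS →
      ∃ p₁ : ℕ, ∀ (p : ℕ) [Fact p.Prime], p₁ ≤ p → ∀ Q : Finset ℕ, (∀ a ∈ Q, a < p) →
        ¬ (∀ n : ℕ, n < p → ((Q ×ˢ Q).filter
            (fun ab : ℕ × ℕ => ab.1 < ab.2 ∧ (ab.1 + ab.2) % p = n)).card =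
              if n ≠ 0 ∧ legendreSym p n = 1 then 1 else 0) := by
  rintro ⟨δ, hδ, p₀, hmain⟩
  refine ⟨max (max p₀ (⌈(23 : ℝ) ^ (1 / δ)⌉₊ + 2)) 5, ?_⟩
  intro p _ hp Q hQ hperf
  have hpprime : p.Prime := Fact.out
  have hp5 : 5 ≤ p := le_of_max_le_right hp
  have hp₀ : p₀ ≤ p := le_of_max_le_left (le_of_max_le_left hp)
  have hceil' : ⌈(23 : ℝ) ^ (1 / δ)⌉₊ + 2 ≤ p := le_of_max_le_right (le_of_max_le_left hp)
  have h4 : (4 : ZMod p) ≠ 0 := four_ne_zero_zmod p hp5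
  have hqq : Q.card * Q.card ≤ 2 * p + Q.card := qrp_card_sq_le p Q hperf
  obtain ⟨N, rfl⟩ : ∃ N, p = N + 1 := ⟨p - 1, (Nat.succ_pred_eq_of_pos hpprime.pos).symm⟩
  -- digits of N = p - 1 (adapted from `charPSparseSOS_false_without_legendre`): N = a * b + r, 1 ≤ r ≤ a
  set a := Nat.sqrt N with ha
  set b := (N - 1) / a with hb
  set r := N - a * b with hr
  have hN4 : 4 ≤ N := by omega
  have ha1 : 1 ≤ a := by rw [ha]; exact Nat.le_sqrt.mpr (by nlinarith)
  have hdm : N - 1 = a * b + (N - 1) % a := by rw [hb]; exact (Nat.div_add_mod (N - 1) a).symm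
  have hmod : (N - 1) % a < a := Nat.mod_lt _ ha1
  have hNabr : N = a * b + r := by omega
  have hr1 : 1 ≤ r := by omega
  have hra : r ≤ a := by omega
  have haa : a * a ≤ N := by rw [ha]; exact Nat.sqrt_le N
  have hNlt : N < (a + 1) * (a + 1) := by rw [ha]; exact Nat.lt_succ_sqrt N
  have hb_le : b ≤ a + 2 := by
    rw [hb]
    have : N - 1 ≤ a * (a + 2) := by
      have : N ≤ a * (a + 2) := by nlinarith
      omega
    calc (N - 1) / a ≤ (a * (a + 2)) / a := Nat.div_le_div_right this
      _ = a + 2 := Nat.mul_div_cancel_left _ ha1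
  have haN : a ≤ N := (Nat.le_mul_self a).trans haa
  -- the crux applied to the seven-square witness
  obtain ⟨c, g, hdeg, hdvd, hsupp⟩ := qrp_witness N h4 Q hQ hperf a b r hNabr hr1 haN
  have key := hmain (N + 1) hp₀ (ZMod (N + 1)) 7 c g
  -- reals
  have hp0 : (0 : ℝ) < ((N + 1 : ℕ) : ℝ) := by exact_mod_cast Nat.succ_pos N
  have hceil : (23 : ℝ) ^ (1 / δ) ≤ ((N + 1 : ℕ) : ℝ) := by
    have h1 : (⌈(23 : ℝ) ^ (1 / δ)⌉₊ : ℝ) ≤ ((N + 1 : ℕ) : ℝ) := by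
      have : ⌈(23 : ℝ) ^ (1 / δ)⌉₊ ≤ N + 1 := by omega
      exact_mod_cast this
    exact le_trans (Nat.le_ceil _) h1
  have hpδ : (23 : ℝ) ≤ ((N + 1 : ℕ) : ℝ) ^ δ := by
    have : ((23 : ℝ) ^ (1 / δ)) ^ δ ≤ ((N + 1 : ℕ) : ℝ) ^ δ :=
      Real.rpow_le_rpow (by positivity) hceil hδ.le
    rwa [← Real.rpow_mul (by norm_num), one_div_mul_cancel hδ.ne', Real.rpow_one] at this
  have hs : ((7 : ℕ) : ℝ) ≤ ((N + 1 : ℕ) : ℝ) ^ δ := le_trans (by norm_num) hpδ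
  have hsplit : ((N + 1 : ℕ) : ℝ) ^ (1 / 2 + δ) =
      Real.sqrt ((N + 1 : ℕ) : ℝ) * ((N + 1 : ℕ) : ℝ) ^ δ := by
    rw [Real.rpow_add hp0, ← Real.sqrt_eq_rpow]
  have hbound := key hs hdeg hdvd
  -- bookkeeping
  have hb' : (b : ℝ) ≤ a + 2 := by exact_mod_cast hb_le
  have hr' : (r : ℝ) ≤ a := by exact_mod_cast hra
  have hsqrt : (a : ℝ) ≤ Real.sqrt ((N + 1 : ℕ) : ℝ) := by
    rw [← Real.sqrt_sq (Nat.cast_nonneg a)]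
    apply Real.sqrt_le_sqrt
    have : ((a * a : ℕ) : ℝ) ≤ ((N + 1 : ℕ) : ℝ) := by exact_mod_cast haa.trans (Nat.le_succ N)
    push_cast at this ⊢; nlinarith
  have h4le : (4 : ℝ) ≤ ((N + 1 : ℕ) : ℝ) := by exact_mod_cast (show 4 ≤ N + 1 by omega)
  have hsqrt2 : (2 : ℝ) ≤ Real.sqrt ((N + 1 : ℕ) : ℝ) := Real.le_sqrt_of_sq_le (by nlinarith)
  have hss : Real.sqrt ((N + 1 : ℕ) : ℝ) * Real.sqrt ((N + 1 : ℕ) : ℝ) = ((N + 1 : ℕ) : ℝ) :=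
    Real.mul_self_sqrt hp0.le
  have hq : (Q.card : ℝ) * Q.card ≤ 2 * ((N + 1 : ℕ) : ℝ) + Q.card := by exact_mod_cast hqq
  have hq' : (Q.card : ℝ) ≤ 2 * Real.sqrt ((N + 1 : ℕ) : ℝ) + 1 := by
    by_contra hlt
    rw [not_le] at hlt
    have h1 : 0 < ((Q.card : ℝ) - 2 * Real.sqrt ((N + 1 : ℕ) : ℝ) - 1) *
        ((Q.card : ℝ) + 2 * Real.sqrt ((N + 1 : ℕ) : ℝ) - 1) :=
      mul_pos (by linarith) (by linarith)
    nlinarith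
  rw [hsplit] at hbound
  set S := ∑ i, ((g i).support.card : ℝ)
  set sq := Real.sqrt ((N + 1 : ℕ) : ℝ)
  set pδ := ((N + 1 : ℕ) : ℝ) ^ δ
  have h1 : S ≤ 12 * sq + 11 := by linarith
  have h2 : 23 * sq ≤ sq * pδ := by nlinarith
  linarith

end

end Summit.ValiantsHypothesis.ValiantsHypothesis.Theorems.CharPSparseSOSTwoCusp
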